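import Mathlib
import HarnessLib
import Summits.HubbardSuperconductivity.HubbardSuperconductivity.Theorems.KLProgrammeKLRegimeEngineV8Defs
import Summits.HubbardSuperconductivity.HubbardSuperconductivity.Theorems.KLProgrammeKLRegimeSplitSymInterpExact

/-!
# Route `KLProgramme` — ENGINE child 19918, two-leg slot at scale `0`: the engine's volume threshold `klEngL₃ β U ≤ L` ALREADY dominates
# every degree budget of the form `2^22 · 16^{n_β}`, so a frame of degree `≤ 2^21 · 16^{n_β}` is reproduced EXACTLY by the symmetrised
# interpolant at every engine volume (no package change needed for a degree guard)

Cell `gate-hubbard-kl`, seat p2 (g9, bundle typist).  Context: p1b's Δ25 candidate F2 (memo `SCALE0-TWOLEG-EXPORTS.md`, evidence on 19918) —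
at scale `0` the two-leg piece subtracts the CONTINUUM frame `K` from data that sees `K` only at lattice momenta, so (E3c)₀ is false for
lattice-invisible (degree-`L`) frame perturbations; the preferred repair (R-deg) restricts admissible frames to degree `< L/2`, where p1b's
`evalM_symInterp_latticeValues_of_degree_le` (`…SymInterpExact`) gives `I_L(K∘p) = K` exactly.  This file supplies the ARITHMETIC that makes a
degree clause typable with the frame class's OWN arguments (`N = nScales β`) and dischargeable at the engine's OWN volume threshold:

* `four_pow_nScales_le` / `sixteen_pow_nScales_le`: `4^{n_β} ≤ e₀β/π`, `16^{n_β} ≤ β²/(1024π²)` for `β ≥ klBetaMin` (`e₀ = klE0 = 1/32`,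
  `n_β = ⌊log₄(e₀β/π)⌋`);
* `two_pow_mul_sixteen_pow_nScales_lt_of_klEngL₃_le`: `klEngL₃ β U ≤ L ⇒ 2^22·16^{n_β} < L` — for EVERY `U` (`klEngL₃ β U =
  2^10(⌈|β|⌉₊+1)²(⌈|U|⁻¹⌉₊+1)² ≥ 1024 β² > 4096 β²/π²`);
* `degree_le_half_of_klEngL₃_le`: a frame with `K.degree ≤ 2^21·16^{n_β}` has `K.degree ≤ L/2` at every `L ≥ klEngL₃ β U`;
* `evalM_symInterp_latticeValues_of_klEngL₃_le`: hence `evalM (symInterp L (K∘p)) = evalM K` there (p1b's lemma, by name).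

The budget `2^21·16^{n_β}` is the one child 2's Jackson iterates can certify (`ctIterJ … = jacksonFrame d …` has degree `d + d`, and the `d` of
`ct_oneVolume_thresholdsJT` admits `d ≤ 2^20·16^{n_β}`; memo RDEG-BUNDLE-KIT.md).  Proofs only; no definitions; nothing about the model is asserted.
-/

noncomputable section

namespace Summit.HubbardSuperconductivity.HubbardSuperconductivity.Theorems.KLRegimeSplit

set_option linter.dupNamespace false -- summit = problem name (single-conjunct summit), D-0017

open Real Literature.MathematicalPhysics.QuantumLattice Literature.Probability.LatticeModels
open Summit.HubbardSuperconductivity.HubbardSuperconductivity.Theorems.KLProgrammeLegKernels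
open Summit.HubbardSuperconductivity.HubbardSuperconductivity.Theorems.EngineV8

/-! ## §1 The depth `n_β` against `β` -/

/-- For `β ≥ klBetaMin = 128` the floor argument of `n_β` is at least `1`: `1 ≤ e₀β/π`. -/
theorem one_le_klE0_mul_div_pi' {β : ℝ} (hβ : klBetaMin ≤ β) : 1 ≤ klE0 * β / π := by
  rw [le_div_iff₀ Real.pi_pos, klE0]
  have : (128 : ℝ) ≤ β := by simpa [klBetaMin] using hβ
  nlinarith [Real.pi_lt_four]

/-- **`4^{n_β} ≤ e₀β/π`** (`n_β = ⌊log₄(e₀β/π)⌋ ≤ log₄(e₀β/π)`). -/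
theorem four_pow_nScales_le {β : ℝ} (hβ : klBetaMin ≤ β) : (4 : ℝ) ^ nScales β ≤ klE0 * β / π := by
  have hx1 := one_le_klE0_mul_div_pi' hβ
  have hx : 0 < klE0 * β / π := lt_of_lt_of_le one_pos hx1
  set y : ℝ := Real.logb 4 (klE0 * β / π) with hy
  have hy0 : 0 ≤ y := Real.logb_nonneg (by norm_num) hx1
  have hfl : ((nScales β : ℕ) : ℝ) ≤ y := Nat.floor_le hy0
  have h1 : (4 : ℝ) ^ ((nScales β : ℕ) : ℝ) ≤ (4 : ℝ) ^ y := Real.rpow_le_rpow_of_exponent_le (by norm_num) hfl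
  rw [Real.rpow_natCast] at h1
  have h2 : (4 : ℝ) ^ y = klE0 * β / π := by rw [hy]; exact Real.rpow_logb (by norm_num) (by norm_num) hx
  rwa [h2] at h1

/-- **`16^{n_β} ≤ β²/(1024π²)`** (`= (e₀β/π)²`, `e₀ = 1/32`). -/
theorem sixteen_pow_nScales_le {β : ℝ} (hβ : klBetaMin ≤ β) : (16 : ℝ) ^ nScales β ≤ β ^ 2 / (1024 * π ^ 2) := by
  have h4 := four_pow_nScales_le hβ
  have h40 : (0 : ℝ) ≤ (4 : ℝ) ^ nScales β := by positivity
  have hsq : ((4 : ℝ) ^ nScales β) ^ 2 ≤ (klE0 * β / π) ^ 2 := pow_le_pow_left₀ h40 h4 2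
  have h16 : (16 : ℝ) ^ nScales β = ((4 : ℝ) ^ nScales β) ^ 2 := by
    rw [← pow_mul, mul_comm, pow_mul]; norm_num
  rw [h16]
  have hπ : (0 : ℝ) < π := Real.pi_pos
  calc ((4 : ℝ) ^ nScales β) ^ 2 ≤ (klE0 * β / π) ^ 2 := hsq
    _ = β ^ 2 / (1024 * π ^ 2) := by rw [klE0]; field_simp; ring

/-! ## §2 The engine's volume threshold dominates the degree budget -/

/-- **`klEngL₃ β U ≤ L ⇒ 2^22·16^{n_β} < L`**, for every `U` (`klEngL₃ β U ≥ 2^10(⌈|β|⌉₊+1)² ≥ 1024β²`, while `2^22·16^{n_β} ≤ 4096β²/π² < 1024β²`). -/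
theorem two_pow_mul_sixteen_pow_nScales_lt_of_klEngL₃_le {β U : ℝ} (hβ : klBetaMin ≤ β) {L : ℕ} (hL : klEngL₃ β U ≤ L) :
    2 ^ 22 * 16 ^ nScales β < L := by
  have h128 : (128 : ℝ) ≤ β := by simpa [klBetaMin] using hβ
  have hβ0 : (0 : ℝ) < β := by linarith
  have h16 := sixteen_pow_nScales_le hβ
  have hπ3 : (3 : ℝ) < π := Real.pi_gt_three
  have hπ2 : (9 : ℝ) < π ^ 2 := by nlinarith
  -- real-valued comparison `2^22·16^{n_β} < klEngL₃ β U`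
  have hceil : β ≤ (⌈|β|⌉₊ : ℝ) := (le_abs_self β).trans (Nat.le_ceil _)
  have hLreal : (1024 : ℝ) * β ^ 2 ≤ (klEngL₃ β U : ℝ) := by
    unfold klEngL₃
    push_cast
    have h1 : (1 : ℝ) ≤ ((⌈|U|⁻¹⌉₊ : ℝ) + 1) ^ 2 := by
      have : (0 : ℝ) ≤ (⌈|U|⁻¹⌉₊ : ℝ) := Nat.cast_nonneg _
      nlinarith
    have h2 : β ^ 2 ≤ ((⌈|β|⌉₊ : ℝ) + 1) ^ 2 := by nlinarith
    have h3 : (0 : ℝ) ≤ ((⌈|β|⌉₊ : ℝ) + 1) ^ 2 := by positivity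
    nlinarith
  have hlt : ((2 : ℕ) ^ 22 * 16 ^ nScales β : ℕ) < (klEngL₃ β U : ℝ) := by
    push_cast
    have hA : (2 : ℝ) ^ 22 * (16 : ℝ) ^ nScales β ≤ 2 ^ 22 * (β ^ 2 / (1024 * π ^ 2)) :=
      mul_le_mul_of_nonneg_left h16 (by positivity)
    have hB : (2 : ℝ) ^ 22 * (β ^ 2 / (1024 * π ^ 2)) < 1024 * β ^ 2 := by
      rw [show (2 : ℝ) ^ 22 * (β ^ 2 / (1024 * π ^ 2)) = 4096 * β ^ 2 / π ^ 2 by ring]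
      rw [div_lt_iff₀ (by positivity)]
      nlinarith [sq_nonneg β, hβ0]
    linarith
  exact_mod_cast hlt.trans_le (by exact_mod_cast hL : (klEngL₃ β U : ℝ) ≤ (L : ℝ))

/-- **Degree guard at the engine's volumes**: a frame with `K.degree ≤ 2^21·16^{n_β}` has `K.degree ≤ L/2` whenever `klEngL₃ β U ≤ L`. -/
theorem degree_le_half_of_klEngL₃_le {β U : ℝ} (hβ : klBetaMin ≤ β) {L : ℕ} (hL : klEngL₃ β U ≤ L) {K : TrigPolyC4v}
    (hK : K.degree ≤ 2 ^ 21 * 16 ^ nScales β) : K.degree ≤ L / 2 := by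
  have h := two_pow_mul_sixteen_pow_nScales_lt_of_klEngL₃_le (U := U) hβ hL
  rw [Nat.le_div_iff_mul_le two_pos]
  have : 2 ^ 21 * 16 ^ nScales β * 2 = 2 ^ 22 * 16 ^ nScales β := by ring
  calc K.degree * 2 ≤ 2 ^ 21 * 16 ^ nScales β * 2 := Nat.mul_le_mul_right 2 hK
    _ = 2 ^ 22 * 16 ^ nScales β := this
    _ ≤ L := h.le

/-! ## §3 Exact reproduction at the engine's volumes (p1b's lemma, by name) -/

/-- **`I_L(K∘p) = K` on `Momentum` at every engine volume**, for frames within the degree budget `2^21·16^{n_β}`: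
`evalM (symInterp L (k⃗ ↦ K(p_k⃗))) = evalM K` whenever `klEngL₃ β U ≤ L` (`…SymInterpExact.evalM_symInterp_latticeValues_of_degree_le`). -/
theorem evalM_symInterp_latticeValues_of_klEngL₃_le {β U : ℝ} (hβ : klBetaMin ≤ β) (L : ℕ) [NeZero L] (hL : klEngL₃ β U ≤ L)
    {K : TrigPolyC4v} (hK : K.degree ≤ 2 ^ 21 * 16 ^ nScales β) :
    evalM (symInterp L (fun k => K.eval (latticeMomentum L k))) = evalM K :=
  evalM_symInterp_latticeValues_of_degree_le L K (degree_le_half_of_klEngL₃_le hβ hL hK)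

/-- The same at a point of `Fin 2 → ℝ`. -/
theorem eval_symInterp_latticeValues_of_klEngL₃_le {β U : ℝ} (hβ : klBetaMin ≤ β) (L : ℕ) [NeZero L] (hL : klEngL₃ β U ≤ L)
    {K : TrigPolyC4v} (hK : K.degree ≤ 2 ^ 21 * 16 ^ nScales β) (p : Fin 2 → ℝ) :
    (symInterp L (fun k => K.eval (latticeMomentum L k))).eval p = K.eval p :=
  eval_symInterp_latticeValues_of_degree_le L K (degree_le_half_of_klEngL₃_le hβ hL hK) p

/-! ## §4 The doubled budget `2^22·16^{n_β}` is still dominated (`π² > 8`): the cap the gen-6 candidate bundle `klPredsV15` carries -/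

/-- **`klEngL₃ β U ≤ L ⇒ 2^23·16^{n_β} < L`**, for every `U` (`2^23·16^{n_β} ≤ 8192β²/π² < 1024β² ≤ klEngL₃ β U`, using `π² > 8`). -/
theorem two_pow_23_mul_sixteen_pow_nScales_lt_of_klEngL₃_le {β U : ℝ} (hβ : klBetaMin ≤ β) {L : ℕ} (hL : klEngL₃ β U ≤ L) :
    2 ^ 23 * 16 ^ nScales β < L := by
  have h128 : (128 : ℝ) ≤ β := by simpa [klBetaMin] using hβ
  have hβ0 : (0 : ℝ) < β := by linarith
  have h16 := sixteen_pow_nScales_le hβ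
  have hπ3 : (3 : ℝ) < π := Real.pi_gt_three
  have hπ2 : (9 : ℝ) < π ^ 2 := by nlinarith
  have hceil : β ≤ (⌈|β|⌉₊ : ℝ) := (le_abs_self β).trans (Nat.le_ceil _)
  have hLreal : (1024 : ℝ) * β ^ 2 ≤ (klEngL₃ β U : ℝ) := by
    unfold klEngL₃
    push_cast
    have h1 : (1 : ℝ) ≤ ((⌈|U|⁻¹⌉₊ : ℝ) + 1) ^ 2 := by
      have : (0 : ℝ) ≤ (⌈|U|⁻¹⌉₊ : ℝ) := Nat.cast_nonneg _
      nlinarith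
    have h2 : β ^ 2 ≤ ((⌈|β|⌉₊ : ℝ) + 1) ^ 2 := by nlinarith
    have h3 : (0 : ℝ) ≤ ((⌈|β|⌉₊ : ℝ) + 1) ^ 2 := by positivity
    nlinarith
  have hlt : ((2 : ℕ) ^ 23 * 16 ^ nScales β : ℕ) < (klEngL₃ β U : ℝ) := by
    push_cast
    have hA : (2 : ℝ) ^ 23 * (16 : ℝ) ^ nScales β ≤ 2 ^ 23 * (β ^ 2 / (1024 * π ^ 2)) :=
      mul_le_mul_of_nonneg_left h16 (by positivity)
    have hB : (2 : ℝ) ^ 23 * (β ^ 2 / (1024 * π ^ 2)) < 1024 * β ^ 2 := by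
      rw [show (2 : ℝ) ^ 23 * (β ^ 2 / (1024 * π ^ 2)) = 8192 * β ^ 2 / π ^ 2 by ring]
      rw [div_lt_iff₀ (by positivity)]
      nlinarith [sq_nonneg β, hβ0]
    linarith
  exact_mod_cast hlt.trans_le (by exact_mod_cast hL : (klEngL₃ β U : ℝ) ≤ (L : ℝ))

/-- **Degree guard at the engine's volumes, doubled budget**: `K.degree ≤ 2^22·16^{n_β}` gives `K.degree ≤ L/2` whenever `klEngL₃ β U ≤ L`. -/
theorem degree_le_half_of_klEngL₃_le' {β U : ℝ} (hβ : klBetaMin ≤ β) {L : ℕ} (hL : klEngL₃ β U ≤ L) {K : TrigPolyC4v}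
    (hK : K.degree ≤ 2 ^ 22 * 16 ^ nScales β) : K.degree ≤ L / 2 := by
  have h := two_pow_23_mul_sixteen_pow_nScales_lt_of_klEngL₃_le (U := U) hβ hL
  rw [Nat.le_div_iff_mul_le two_pos]
  have : 2 ^ 22 * 16 ^ nScales β * 2 = 2 ^ 23 * 16 ^ nScales β := by ring
  calc K.degree * 2 ≤ 2 ^ 22 * 16 ^ nScales β * 2 := Nat.mul_le_mul_right 2 hK
    _ = 2 ^ 23 * 16 ^ nScales β := this
    _ ≤ L := h.le

/-- **Exact reproduction at the engine's volumes, doubled budget** (p1b's lemma, by name). -/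
theorem evalM_symInterp_latticeValues_of_klEngL₃_le' {β U : ℝ} (hβ : klBetaMin ≤ β) (L : ℕ) [NeZero L] (hL : klEngL₃ β U ≤ L)
    {K : TrigPolyC4v} (hK : K.degree ≤ 2 ^ 22 * 16 ^ nScales β) :
    evalM (symInterp L (fun k => K.eval (latticeMomentum L k))) = evalM K :=
  evalM_symInterp_latticeValues_of_degree_le L K (degree_le_half_of_klEngL₃_le' hβ hL hK)

end Summit.HubbardSuperconductivity.HubbardSuperconductivity.Theorems.KLRegimeSplit

end
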